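import Literature.Analysis.FluidPDE.FourierL2Convolution
import Mathlib.Algebra.Order.Chebyshev
import HarnessLib

/-!
# The Fourier-side Navier–Stokes nonlinearity in the majorant calculus

Third file of the weighted-`L²` Fourier-side construction of the local smooth solution of the
Navier–Stokes system with `H¹`-controlled lifespan (discharge of
`Literature.Analysis.FluidPDE.tao2011_fourier_local_existence`; Tao 2013, Thm. 5.4 (ii)+(iv)).
The tree's projected nonlinearity `N(v, w)(ξ)_l = -2πi ∑_{j,k} m_{jkl}(ξ) (v_j ⋆ w_k)(ξ)`
(`FourierNS.nonlin`, symbol `|m_{jkl}(ξ)| ≤ 2‖ξ‖`) and pressure symbol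
`q(v, w)(ξ) = -∑_{j,k} (ξⱼξₖ/‖ξ‖²)(v_j ⋆ w_k)(ξ)` (`FourierNS.presSymbol`) are estimated in
`NSFourierBilinear` through pointwise decay (`HasDecay`). Here they are bounded by the majorant
convolution of `FourierL2Convolution`: with the scalar majorant `V(η) = ∑ⱼ ‖v η j‖ₑ`,

* `enorm_nonlin_apply_le`: `‖N(v, w)(ξ)_l‖ₑ ≤ 4π (card ι)² ‖ξ‖ (V ⋆ₗ W)(ξ)` — unconditionally;
* `enorm_presSymbol_le`: `‖q(v, w)(ξ)‖ₑ ≤ (card ι)² (V ⋆ₗ W)(ξ)`;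
* bilinearity of `N` and `q` for coefficient fields with square-integrable components
  (`nonlin_sub_left_of_memLp`, …, `nonlin_self_sub_self_of_memLp`), the form needed for
  differences of Picard iterates in the `L²` class;
* the elementary comparisons between the majorant `V`, the components and the square sum
  `∑ⱼ ‖v η j‖ₑ²` (`enorm_apply_le_majorant`, `majorant_sq_le`).

## References

* P. G. Lemarié-Rieusset, *The Navier–Stokes problem in the 21st century*, CRC 2016, §6.1
  (the symbols), §8.5.
* T. Tao, Anal. PDE 6 (2013) = arXiv:1108.1165, §2. [Tao2011]
-/

noncomputable section

open MeasureTheory Real Set Filter Function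
open scoped ENNReal NNReal
open _root_.Topology

namespace Literature.Analysis.FluidPDE.FourierNS

variable {ι : Type*} [Fintype ι] [DecidableEq ι]

/-! ### The scalar majorant of a coefficient field -/

omit [DecidableEq ι] in
/-- Each component is dominated by the majorant: `‖v η j‖ₑ ≤ ∑ⱼ ‖v η j‖ₑ`. [folklore] -/
theorem enorm_apply_le_majorant (v : EuclideanSpace ℝ ι → ι → ℂ) (η : EuclideanSpace ℝ ι) (j : ι) :
    ‖v η j‖ₑ ≤ ∑ i, ‖v η i‖ₑ :=
  Finset.single_le_sum (f := fun i => ‖v η i‖ₑ) (fun _ _ => zero_le) (Finset.mem_univ j)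

omit [DecidableEq ι] in
/-- The sup norm of `v η` is dominated by the majorant: `‖v η‖ₑ ≤ ∑ⱼ ‖v η j‖ₑ`. [folklore] -/
theorem enorm_le_majorant (v : EuclideanSpace ℝ ι → ι → ℂ) (η : EuclideanSpace ℝ ι) :
    ‖v η‖ₑ ≤ ∑ i, ‖v η i‖ₑ := by
  rw [← ofReal_norm, ← ENNReal.ofReal_sum_of_nonneg (fun i _ => norm_nonneg _) |>.trans
    (Finset.sum_congr rfl fun i _ => ofReal_norm (v η i))]
  refine ENNReal.ofReal_le_ofReal ((pi_norm_le_iff_of_nonneg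
    (Finset.sum_nonneg fun i _ => norm_nonneg _)).2 fun i => ?_)
  exact Finset.single_le_sum (f := fun i => ‖v η i‖) (fun i _ => norm_nonneg _) (Finset.mem_univ i)

omit [DecidableEq ι] in
/-- Cauchy–Schwarz for the majorant: `(∑ⱼ ‖v η j‖ₑ)² ≤ card ι · ∑ⱼ ‖v η j‖ₑ²`. [folklore] -/
theorem majorant_sq_le (v : EuclideanSpace ℝ ι → ι → ℂ) (η : EuclideanSpace ℝ ι) :
    (∑ i, ‖v η i‖ₑ) ^ 2 ≤ (Fintype.card ι : ℝ≥0∞) * ∑ i, ‖v η i‖ₑ ^ 2 := by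
  have hr : (∑ i, ‖v η i‖) ^ 2 ≤ (Fintype.card ι : ℝ) * ∑ i, ‖v η i‖ ^ 2 := by
    have := sq_sum_le_card_mul_sum_sq (s := Finset.univ) (f := fun i => ‖v η i‖)
    simpa [Finset.card_univ] using this
  calc (∑ i, ‖v η i‖ₑ) ^ 2 = ENNReal.ofReal ((∑ i, ‖v η i‖) ^ 2) := by
        rw [ENNReal.ofReal_pow (Finset.sum_nonneg fun i _ => norm_nonneg _),
          ENNReal.ofReal_sum_of_nonneg (fun i _ => norm_nonneg _)]
        simp_rw [ofReal_norm]
    _ ≤ ENNReal.ofReal ((Fintype.card ι : ℝ) * ∑ i, ‖v η i‖ ^ 2) := ENNReal.ofReal_le_ofReal hr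
    _ = (Fintype.card ι : ℝ≥0∞) * ∑ i, ‖v η i‖ₑ ^ 2 := by
        rw [ENNReal.ofReal_mul (by positivity), ENNReal.ofReal_natCast,
          ENNReal.ofReal_sum_of_nonneg (fun i _ => sq_nonneg _)]
        congr 1
        refine Finset.sum_congr rfl fun i _ => ?_
        rw [ENNReal.ofReal_pow (norm_nonneg _), ofReal_norm]

omit [DecidableEq ι] in
/-- Measurability of the majorant. [folklore] -/
theorem aemeasurable_majorant {v : EuclideanSpace ℝ ι → ι → ℂ}
    (hv : AEStronglyMeasurable v volume) :
    AEMeasurable (fun η => ∑ i, ‖v η i‖ₑ) volume :=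
  (Finset.aemeasurable_sum Finset.univ (fun i _ => (aesm_apply hv i).enorm)).congr
    (ae_of_all _ fun η => Finset.sum_apply η Finset.univ (fun i x => ‖v x i‖ₑ))

/-! ### The nonlinearity and the pressure symbol bounded by the majorant convolution -/

section Nonlin

variable (v w : EuclideanSpace ℝ ι → ι → ℂ)

omit [DecidableEq ι] in
/-- Each component convolution is dominated by the majorant convolution:
`‖(v_j ⋆ w_k)(ξ)‖ₑ ≤ (V ⋆ₗ W)(ξ)`. [folklore] -/
theorem enorm_fconv_apply_le_lconv_majorant (ξ : EuclideanSpace ℝ ι) (j k : ι) :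
    ‖fconv (v · j) (w · k) ξ‖ₑ ≤
      ((fun η => ∑ i, ‖v η i‖ₑ) ⋆ₗ (fun η => ∑ i, ‖w η i‖ₑ)) ξ :=
  (enorm_fconv_le_lconv _ _ ξ).trans (lconv_mono (fun η => enorm_apply_le_majorant v η j)
    (fun η => enorm_apply_le_majorant w η k) ξ)

/-- **The nonlinearity is dominated by the majorant convolution**:
`‖N(v, w)(ξ)_l‖ₑ ≤ 4π (card ι)² ‖ξ‖ (V ⋆ₗ W)(ξ)`, `V = ∑ⱼ ‖vⱼ‖ₑ`, `W = ∑ₖ ‖wₖ‖ₑ`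
(symbol bound `|m_{jkl}(ξ)| ≤ 2‖ξ‖`), with no hypothesis on `v`, `w`. [folklore] -/
theorem enorm_nonlin_apply_le (ξ : EuclideanSpace ℝ ι) (l : ι) :
    ‖nonlin v w ξ l‖ₑ ≤ ENNReal.ofReal (4 * π) * (Fintype.card ι : ℝ≥0∞) ^ 2 *
      ENNReal.ofReal ‖ξ‖ * ((fun η => ∑ i, ‖v η i‖ₑ) ⋆ₗ (fun η => ∑ i, ‖w η i‖ₑ)) ξ := by
  set M := ((fun η => ∑ i, ‖v η i‖ₑ) ⋆ₗ (fun η => ∑ i, ‖w η i‖ₑ)) ξ with hM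
  rw [nonlin_apply, enorm_mul]
  have h2π : ‖-(2 * (π : ℂ) * Complex.I)‖ₑ = ENNReal.ofReal (2 * π) := by
    rw [← ofReal_norm]
    simp [Complex.norm_real, Real.norm_eq_abs, abs_of_pos Real.pi_pos]
  rw [h2π]
  have hterm : ∀ j k, ‖(lerayDerivSymbol j k l ξ : ℂ) * fconv (v · j) (w · k) ξ‖ₑ ≤
      2 * ENNReal.ofReal ‖ξ‖ * M := fun j k => by
    rw [enorm_mul]
    refine mul_le_mul' ?_ (enorm_fconv_apply_le_lconv_majorant v w ξ j k)
    rw [← ofReal_norm]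
    calc ENNReal.ofReal ‖(lerayDerivSymbol j k l ξ : ℂ)‖ ≤ ENNReal.ofReal (2 * ‖ξ‖) :=
          ENNReal.ofReal_le_ofReal (norm_ofReal_lerayDerivSymbol_le j k l ξ)
      _ = 2 * ENNReal.ofReal ‖ξ‖ := by
          rw [ENNReal.ofReal_mul (by norm_num), ENNReal.ofReal_ofNat]
  calc ENNReal.ofReal (2 * π) * ‖∑ j, ∑ k, (lerayDerivSymbol j k l ξ : ℂ) * fconv (v · j) (w · k) ξ‖ₑ
      ≤ ENNReal.ofReal (2 * π) * ∑ j, ∑ k, ‖(lerayDerivSymbol j k l ξ : ℂ) *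
          fconv (v · j) (w · k) ξ‖ₑ := by
        gcongr
        exact (enorm_sum_le _ _).trans (Finset.sum_le_sum fun j _ => enorm_sum_le _ _)
    _ ≤ ENNReal.ofReal (2 * π) * ∑ _j : ι, ∑ _k : ι, 2 * ENNReal.ofReal ‖ξ‖ * M := by
        gcongr with j _ k _
        exact hterm j k
    _ = ENNReal.ofReal (4 * π) * (Fintype.card ι : ℝ≥0∞) ^ 2 * ENNReal.ofReal ‖ξ‖ * M := by
        simp only [Finset.sum_const, Finset.card_univ, nsmul_eq_mul]
        rw [show ENNReal.ofReal (4 * π) = 2 * ENNReal.ofReal (2 * π) by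
            rw [← ENNReal.ofReal_ofNat 2, ← ENNReal.ofReal_mul (by norm_num)]
            congr 1; ring]
        ring

omit [DecidableEq ι] in
/-- **The pressure symbol is dominated by the majorant convolution**:
`‖q(v, w)(ξ)‖ₑ ≤ (card ι)² (V ⋆ₗ W)(ξ)` (the multiplier `ξⱼξₖ/‖ξ‖²` has modulus `≤ 1`).
[folklore] -/
theorem enorm_presSymbol_le (ξ : EuclideanSpace ℝ ι) :
    ‖presSymbol v w ξ‖ₑ ≤ (Fintype.card ι : ℝ≥0∞) ^ 2 *
      ((fun η => ∑ i, ‖v η i‖ₑ) ⋆ₗ (fun η => ∑ i, ‖w η i‖ₑ)) ξ := by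
  set M := ((fun η => ∑ i, ‖v η i‖ₑ) ⋆ₗ (fun η => ∑ i, ‖w η i‖ₑ)) ξ with hM
  rw [presSymbol, enorm_neg]
  have hterm : ∀ j k, ‖((ξ j * ξ k / ‖ξ‖ ^ 2 : ℝ) : ℂ) * fconv (v · j) (w · k) ξ‖ₑ ≤ M := by
    intro j k
    rw [enorm_mul]
    calc ‖((ξ j * ξ k / ‖ξ‖ ^ 2 : ℝ) : ℂ)‖ₑ * ‖fconv (v · j) (w · k) ξ‖ₑ
        ≤ 1 * M := by
          refine mul_le_mul' ?_ (enorm_fconv_apply_le_lconv_majorant v w ξ j k)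
          rw [← ofReal_norm, ← ENNReal.ofReal_one, Complex.norm_real, Real.norm_eq_abs]
          exact ENNReal.ofReal_le_ofReal (abs_mul_div_norm_sq_le_one j k ξ)
      _ = M := one_mul _
  calc ‖∑ j, ∑ k, ((ξ j * ξ k / ‖ξ‖ ^ 2 : ℝ) : ℂ) * fconv (v · j) (w · k) ξ‖ₑ
      ≤ ∑ j, ∑ k, ‖((ξ j * ξ k / ‖ξ‖ ^ 2 : ℝ) : ℂ) * fconv (v · j) (w · k) ξ‖ₑ :=
        (enorm_sum_le _ _).trans (Finset.sum_le_sum fun j _ => enorm_sum_le _ _)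
    _ ≤ ∑ _j : ι, ∑ _k : ι, M := by gcongr with j _ k _; exact hterm j k
    _ = (Fintype.card ι : ℝ≥0∞) ^ 2 * M := by
        simp only [Finset.sum_const, Finset.card_univ, nsmul_eq_mul]; ring

/-! ### Bilinearity for square-integrable coefficient fields -/

variable {v w}
variable {v₁ v₂ w₁ w₂ : EuclideanSpace ℝ ι → ι → ℂ}

/-- Bilinearity of `N` in the first slot, for fields with square-integrable components.
[folklore] -/
theorem nonlin_sub_left_of_memLp (h₁ : ∀ j, MemLp (v₁ · j) 2 volume)
    (h₂ : ∀ j, MemLp (v₂ · j) 2 volume) (hw : ∀ k, MemLp (w · k) 2 volume)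
    (ξ : EuclideanSpace ℝ ι) :
    nonlin (v₁ - v₂) w ξ = nonlin v₁ w ξ - nonlin v₂ w ξ := by
  ext l
  simp only [nonlin_apply, Pi.sub_apply]
  have hsub : ∀ j k, fconv (fun η => v₁ η j - v₂ η j) (w · k) ξ =
      fconv (v₁ · j) (w · k) ξ - fconv (v₂ · j) (w · k) ξ := fun j k =>
    fconv_sub_left (f₁ := (v₁ · j)) (f₂ := (v₂ · j)) (integrable_fconv_integrand (h₁ j) (hw k) ξ)
      (integrable_fconv_integrand (h₂ j) (hw k) ξ)
  simp only [hsub, mul_sub, Finset.sum_sub_distrib]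

/-- Bilinearity of `N` in the second slot, for fields with square-integrable components.
[folklore] -/
theorem nonlin_sub_right_of_memLp (hv : ∀ j, MemLp (v · j) 2 volume)
    (h₁ : ∀ k, MemLp (w₁ · k) 2 volume) (h₂ : ∀ k, MemLp (w₂ · k) 2 volume)
    (ξ : EuclideanSpace ℝ ι) :
    nonlin v (w₁ - w₂) ξ = nonlin v w₁ ξ - nonlin v w₂ ξ := by
  ext l
  simp only [nonlin_apply, Pi.sub_apply]
  have hsub : ∀ j k, fconv (v · j) (fun η => w₁ η k - w₂ η k) ξ =
      fconv (v · j) (w₁ · k) ξ - fconv (v · j) (w₂ · k) ξ := fun j k =>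
    fconv_sub_right (g₁ := (w₁ · k)) (g₂ := (w₂ · k)) (integrable_fconv_integrand (hv j) (h₁ k) ξ)
      (integrable_fconv_integrand (hv j) (h₂ k) ξ)
  simp only [hsub, mul_sub, Finset.sum_sub_distrib]

/-- `N(v,v) - N(w,w) = N(v - w, v) + N(w, v - w)` for fields with square-integrable
components. [folklore] -/
theorem nonlin_self_sub_self_of_memLp (hv : ∀ j, MemLp (v · j) 2 volume)
    (hw : ∀ j, MemLp (w · j) 2 volume) (ξ : EuclideanSpace ℝ ι) :
    nonlin v v ξ - nonlin w w ξ = nonlin (v - w) v ξ + nonlin w (v - w) ξ := by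
  rw [nonlin_sub_left_of_memLp hv hw hv, nonlin_sub_right_of_memLp hw hv hw]
  abel

omit [DecidableEq ι] in
/-- Bilinearity of the pressure symbol in the first slot (square-integrable components).
[folklore] -/
theorem presSymbol_sub_left_of_memLp (h₁ : ∀ j, MemLp (v₁ · j) 2 volume)
    (h₂ : ∀ j, MemLp (v₂ · j) 2 volume) (hw : ∀ k, MemLp (w · k) 2 volume)
    (ξ : EuclideanSpace ℝ ι) :
    presSymbol (v₁ - v₂) w ξ = presSymbol v₁ w ξ - presSymbol v₂ w ξ := by
  simp only [presSymbol, Pi.sub_apply]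
  have hsub : ∀ j k, fconv (fun η => v₁ η j - v₂ η j) (w · k) ξ =
      fconv (v₁ · j) (w · k) ξ - fconv (v₂ · j) (w · k) ξ := fun j k =>
    fconv_sub_left (f₁ := (v₁ · j)) (f₂ := (v₂ · j)) (integrable_fconv_integrand (h₁ j) (hw k) ξ)
      (integrable_fconv_integrand (h₂ j) (hw k) ξ)
  simp only [hsub, mul_sub, Finset.sum_sub_distrib, neg_sub', sub_neg_eq_add]

omit [DecidableEq ι] in
/-- Bilinearity of the pressure symbol in the second slot (square-integrable components).
[folklore] -/
theorem presSymbol_sub_right_of_memLp (hv : ∀ j, MemLp (v · j) 2 volume)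
    (h₁ : ∀ k, MemLp (w₁ · k) 2 volume) (h₂ : ∀ k, MemLp (w₂ · k) 2 volume)
    (ξ : EuclideanSpace ℝ ι) :
    presSymbol v (w₁ - w₂) ξ = presSymbol v w₁ ξ - presSymbol v w₂ ξ := by
  simp only [presSymbol, Pi.sub_apply]
  have hsub : ∀ j k, fconv (v · j) (fun η => w₁ η k - w₂ η k) ξ =
      fconv (v · j) (w₁ · k) ξ - fconv (v · j) (w₂ · k) ξ := fun j k =>
    fconv_sub_right (g₁ := (w₁ · k)) (g₂ := (w₂ · k)) (integrable_fconv_integrand (hv j) (h₁ k) ξ)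
      (integrable_fconv_integrand (hv j) (h₂ k) ξ)
  simp only [hsub, mul_sub, Finset.sum_sub_distrib, neg_sub', sub_neg_eq_add]

omit [DecidableEq ι] in
/-- `q(v,v) - q(w,w) = q(v - w, v) + q(w, v - w)` (square-integrable components). [folklore] -/
theorem presSymbol_self_sub_self_of_memLp (hv : ∀ j, MemLp (v · j) 2 volume)
    (hw : ∀ j, MemLp (w · j) 2 volume) (ξ : EuclideanSpace ℝ ι) :
    presSymbol v v ξ - presSymbol w w ξ = presSymbol (v - w) v ξ + presSymbol w (v - w) ξ := by
  rw [presSymbol_sub_left_of_memLp hv hw hv, presSymbol_sub_right_of_memLp hw hv hw]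
  abel

end Nonlin

end Literature.Analysis.FluidPDE.FourierNS

end
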